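import Mathlib.Analysis.Analytic.Basic
import Mathlib.Analysis.Calculus.FDeriv.Basic
import Mathlib.Analysis.Complex.Basic
import Mathlib.LinearAlgebra.BilinearForm.Basic
import Mathlib.LinearAlgebra.Determinant
import Mathlib.MeasureTheory.Measure.Haar.OfBasis
import Mathlib.MeasureTheory.Integral.Bochner.Basic
import Literature.MathematicalPhysics.QuantumLattice.MinkowskiGeometry
import Literature.MathematicalPhysics.QuantumLattice.SchwartzTensor
import Literature.MathematicalPhysics.QuantumLattice.SchwingerOSAxioms
import Literature.MathematicalPhysics.QuantumLattice.WightmanAxioms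
import HarnessLib

-- provenance: harness21/H21/H21/Prelude/QLatticeAQFT/SchwingerWightman.lean @ 29e9553 (interim HEAD d8f2665); M5 mechanical rewrite
/-!
# Analytic continuation between Wightman and Schwinger functions

Trunk `QLatticeAQFT` (G13), item A17 / notion `schwinger_wightman_correspondence`.

The Wightman distributions `𝔚ₙ(x₁, …, xₙ) = ⟪Ω, φ(x₁) ⋯ φ(xₙ) Ω⟫` of a Wightman QFT are boundary
values of functions `𝔚ₙ(z₁, …, zₙ)` holomorphic in the *forward tube*
`𝒯ₙ = {z | Im (z_k − z_{k-1}) ∈ V₊}` (spectral condition; Streater–Wightman Thm. 3-5), and the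
Schwinger functions are their restrictions to *Euclidean points* `z_k = (i x_k⁰, x⃗_k)` with
`0 < x₁⁰ < ⋯ < xₙ⁰` (Osterwalder–Schrader I, §4; Glimm–Jaffe §19). This file provides the
vocabulary needed to *state* this correspondence:

* `complexifyPoint`, `rePart`, `imPart` (real points of `ℂ^{1+d}` and their real/imaginary
  parts), `succDiff` (successive differences `x_k − x_{k-1}`, `x_{-1} = 0`), the base cone
  `tubeCone d n` and the forward tube `forwardTube d n`, `isOpen_forwardTube`;
* Euclidean points `euclideanPoint x = ((i x_k⁰, x⃗_k))_k` and
  `euclideanPoint_mem_forwardTube_of_isTimeOrdered` (real proof);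
* `HasDistributionalBoundaryValue 𝔚 T`: `∫ 𝔚(x + i t η) F(x) dx → T F` as `t → 0⁺` for every
  direction `η` in the base cone of the tube;
* `IsWightmanDistributionOf W n k T`: `T (f₁ ⊗ ⋯ ⊗ fₙ) = ⟪Ω, φ_{k₁}(f₁) ⋯ φ_{kₙ}(fₙ) Ω⟫`;
* `IsWickRotationOf S W k`: `S` is the family of Schwinger functions of the Wightman data `W`;
  `structure OSReconstruction S κ` (a Wightman QFT whose Wick rotation is `S`), the shape of the
  conclusion of the OS reconstruction theorem;
* the complexified Minkowski form `complexMinkowskiForm d` (a `LinearMap.BilinForm ℂ`), the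
  complex Lorentz group `complexLorentzGroup d`, its proper part, the *extended forward tube*
  `extendedForwardTube d n = ⋃_{Λ ∈ L₊(ℂ)} Λ 𝒯ₙ` and the *permuted extended tube*
  `permutedExtendedForwardTube d n = ⋃_σ σ 𝒯ₙ'` (the two auxiliary domains named by the
  inventory notion; the Bargmann–Hall–Wightman extension `exists_extension_extendedForwardTube`
  is stated with `sorry`; the inclusion of non-coincident Euclidean points in the permuted
  extended tube is *not* stated, see the docstring of `permutedExtendedForwardTube`);
* the (sorried, known) symmetry and real analyticity of the Schwinger functions at
  non-coincident Euclidean points, `IsWickRotationOf.schwinger_symmetric` (the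
  `AnalyticOnNhd ℝ` conjunct on `{x | Function.Injective x}` carries the content).

## Sources

* K. Osterwalder, R. Schrader, *Axioms for Euclidean Green's functions*, Comm. Math. Phys. 31
  (1973) 83–112, §4 (from Wightman to Schwinger functions and back), eq. (4.12)–(4.14).
* R. F. Streater, A. S. Wightman, *PCT, Spin and Statistics, and All That* (1964), §2-4 (tubes,
  extended tubes, complex Lorentz group), §2-5 (Bargmann–Hall–Wightman theorem), §3-3 (Wightman
  distributions as boundary values, Thm. 3-5), §3-4 (Schwinger/Euclidean points, Thm. 3-6).
* J. Glimm, A. Jaffe, *Quantum Physics: a functional integral point of view* (2nd ed. 1987),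
  §19.1–19.5 (analytic continuation `S → 𝔚`), §6.1.

## Mathlib

Used: `DifferentiableOn ℂ` on the complex normed space `Fin n → Fin (d + 1) → ℂ`, `𝓝[>]`,
`Filter.Tendsto`, `AnalyticOnNhd ℝ`, the Bochner integral against Lebesgue measure on
`Fin n → SpaceTime d` (`measureSpaceOfInnerProductSpace` + `MeasureSpace.pi`),
`LinearMap.BilinForm` / `LinearMap.mk₂`, `LinearEquiv.automorphismGroup`, `LinearEquiv.det`,
`Matrix.vecCons`. Searched and absent at the pin: tube domains, forward tubes,
Wick rotation, complex Lorentz group, distributional boundary values of holomorphic functions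
(`rg -i 'forward tube|wick rotation|tube domain|boundary value'` in `Mathlib/`: no hits).

## Design choices

* Convention (Streater–Wightman §3-3 rewritten in the points `x_k` rather than the differences
  `ξ_k = x_k − x_{k+1}`): `z ∈ 𝒯ₙ` iff `Im z₀ ∈ V₊` and `Im (z_k − z_{k-1}) ∈ V₊` for `k ≥ 1`,
  i.e. `succDiff (Im z) k ∈ V₊` for all `k` with the convention `z_{-1} = 0`. Including `Im z₀`
  (rather than passing to difference variables) gives a slightly smaller domain than the maximal
  one for translation-invariant `𝔚`, which is harmless for stating holomorphy, and makes the
  Euclidean points with `0 < x₀⁰ < x₁⁰ < ⋯` (`AQFT.IsTimeOrdered`) lie in `𝒯ₙ`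
  (`euclideanPoint_mem_forwardTube`).
* `succDiff` is written with `Matrix.vecCons 0 x ∘ Fin.castSucc` (the non-dependent `Fin.cons`),
  so that `succDiff_zero` / `succDiff_succ` are `rfl`/`simp`.
* Boundary values are taken along rays `x + i t η`, `t → 0⁺`, with `η` in the *base cone*
  `tubeCone d n = {η | succDiff η k ∈ V₊ ∀ k}` of the tube (so that `x + i t η ∈ 𝒯ₙ` for `t > 0`,
  `mem_forwardTube_of_mem_tubeCone`); the outline's shorthand "`η k ∈ V₊` for all `k`" would not
  keep the ray inside `𝒯ₙ`. This is Streater–Wightman §2-3 (boundary values of holomorphic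
  functions in tubes) and Thm. 3-5: `lim_{η → 0, η ∈ cone} 𝔚(x + iη) = 𝔚(x)` in `𝒮'`, restricted
  to rays (equivalent for functions
  of tempered growth in the tube; the ray form is what OS I §4 use).
* Complex points are plain functions `Fin (d + 1) → ℂ` (sup norm; only the complex structure and
  the topology matter); real points are `SpaceTime d = EuclideanSpace ℝ (Fin (d + 1))`, Euclidean
  points are the *same type* read with the Euclidean metric (time = coordinate `0` on both sides,
  outline §0).
* `IsWickRotationOf S W k` fixes, for each `n`, the field labels `k n : Fin n → κ` whose Wightman
  function is continued (for a single scalar field take `κ = Unit`); it constrains `S n` only on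
  time-ordered test functions (`𝒮_<`), exactly as in OS I, eq. (4.12): the extension to all
  non-coincident points is by symmetry (E3) and to coincident points by continuity (E0').
* The complex Lorentz group acts on `Fin (d + 1) → ℂ` by `ℂ`-linear equivalences preserving the
  complexified Minkowski form `complexMinkowskiForm` (bundled as a `LinearMap.BilinForm ℂ`,
  parallel to the bundled real `minkowskiForm d`); "proper" is `det = 1` via the kernel of
  `LinearEquiv.det`, mirroring `MinkowskiGeometry.detHom`.
-/

noncomputable section

open Filter Topology Complex MeasureTheory
open scoped SchwartzMap

namespace Literature.MathematicalPhysics.QuantumLattice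

variable {d : ℕ} {κ : Type*} {n : ℕ}

/-! ### Real and complex points -/

/-- The real point `x ∈ ℝ^{1+d}` viewed in complexified Minkowski space `ℂ^{1+d}`,
`(complexifyPoint x) μ = x μ` (Streater–Wightman (1964), §2-4). [cite: StreaterWightman1964] -/
def complexifyPoint (x : SpaceTime d) : Fin (d + 1) → ℂ := fun μ => (x μ : ℂ)

/-- Components of `complexifyPoint`. [folklore] -/
@[simp]
theorem complexifyPoint_apply (x : SpaceTime d) (μ : Fin (d + 1)) :
    complexifyPoint x μ = (x μ : ℂ) := rfl

/-- The real part `Re z ∈ ℝ^{1+d}` of a complex point `z ∈ ℂ^{1+d}` (componentwise;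
Streater–Wightman (1964), §2-4, `ζ = ξ − iη`). [cite: StreaterWightman1964] -/
def rePart (z : Fin (d + 1) → ℂ) : SpaceTime d := WithLp.toLp 2 fun μ => (z μ).re

/-- The imaginary part `Im z ∈ ℝ^{1+d}` of a complex point `z ∈ ℂ^{1+d}` (componentwise;
Streater–Wightman (1964), §2-4). [cite: StreaterWightman1964] -/
def imPart (z : Fin (d + 1) → ℂ) : SpaceTime d := WithLp.toLp 2 fun μ => (z μ).im

/-- Components of `rePart`. [folklore] -/
@[simp]
theorem rePart_apply (z : Fin (d + 1) → ℂ) (μ : Fin (d + 1)) : rePart z μ = (z μ).re := rfl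

/-- Components of `imPart`. [folklore] -/
@[simp]
theorem imPart_apply (z : Fin (d + 1) → ℂ) (μ : Fin (d + 1)) : imPart z μ = (z μ).im := rfl

/-- A real point has real part itself. [folklore] -/
@[simp]
theorem rePart_complexifyPoint (x : SpaceTime d) : rePart (complexifyPoint x) = x := by
  ext μ; simp

/-- A real point has vanishing imaginary part. [folklore] -/
@[simp]
theorem imPart_complexifyPoint (x : SpaceTime d) : imPart (complexifyPoint x) = 0 := by
  ext μ; simp

/-- `imPart` is additive. [folklore] -/
@[simp]
theorem imPart_add (z w : Fin (d + 1) → ℂ) : imPart (z + w) = imPart z + imPart w := by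
  ext μ; simp

/-- `imPart` commutes with subtraction. [folklore] -/
@[simp]
theorem imPart_sub (z w : Fin (d + 1) → ℂ) : imPart (z - w) = imPart z - imPart w := by
  ext μ; simp

/-- `imPart 0 = 0`. [folklore] -/
@[simp]
theorem imPart_zero : imPart (0 : Fin (d + 1) → ℂ) = 0 := by
  ext μ; simp

/-- The imaginary part of the point `x + (t i) η` on the ray from `x` in direction `iη` is
`t η`. [folklore] -/
theorem imPart_complexifyPoint_add_smul (x η : SpaceTime d) (t : ℝ) :
    imPart (complexifyPoint x + ((t : ℂ) * I) • complexifyPoint η) = t • η := by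
  ext μ; simp

/-! ### Successive differences and the forward tube -/

/-- Successive differences of a finite sequence with the convention `x_{-1} = 0`:
`succDiff x 0 = x 0` and `succDiff x (k + 1) = x (k + 1) − x k`. These are the variables in
which the forward tube is a product of cones (Streater–Wightman (1964), §3-3, the difference
variables `ξ_j`, up to the sign/ordering convention recorded in the module docstring). [cite: StreaterWightman1964] -/
def succDiff {α : Type*} [Sub α] [Zero α] (x : Fin n → α) : Fin n → α :=
  fun k => x k - Matrix.vecCons 0 x (Fin.castSucc k)

/-- `succDiff x 0 = x 0` (the predecessor of index `0` is the origin). [folklore] -/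
@[simp]
theorem succDiff_zero {α : Type*} [AddGroup α] (x : Fin (n + 1) → α) : succDiff x 0 = x 0 := by
  simp [succDiff]

/-- `succDiff x (k + 1) = x (k + 1) - x k`. [folklore] -/
@[simp]
theorem succDiff_succ {α : Type*} [Sub α] [Zero α] (x : Fin (n + 1) → α) (k : Fin n) :
    succDiff x k.succ = x k.succ - x k.castSucc := by
  simp [succDiff]

/-- `succDiff` commutes with any map preserving subtraction (e.g. `imPart`, evaluation at a
coordinate). [folklore] -/
theorem succDiff_map {α β : Type*} [AddGroup α] [AddGroup β] (φ : α → β)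
    (hsub : ∀ a b, φ (a - b) = φ a - φ b) (x : Fin n → α) (k : Fin n) :
    succDiff (fun j => φ (x j)) k = φ (succDiff x k) := by
  cases n with
  | zero => exact k.elim0
  | succ n =>
    refine Fin.cases ?_ (fun j => ?_) k
    · simp [succDiff]
    · simp [hsub]

variable (d n) in
/-- The **base cone** of the forward tube: `n`-tuples `η = (η₀, …, η_{n-1})` of real vectors
whose successive differences lie in the open forward cone, `η₀ ∈ V₊`, `η_k − η_{k-1} ∈ V₊`
(Streater–Wightman (1964), §3-3: in difference variables the cone `V₊ × ⋯ × V₊`). [cite: StreaterWightman1964] -/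
def tubeCone : Set (Fin n → SpaceTime d) := {η | ∀ k, succDiff η k ∈ forwardCone d}

/-- Membership in the base cone. [folklore] -/
@[simp]
theorem mem_tubeCone_iff (η : Fin n → SpaceTime d) :
    η ∈ tubeCone d n ↔ ∀ k, succDiff η k ∈ forwardCone d := Iff.rfl

variable (d n) in
/-- The **forward tube** `𝒯ₙ ⊆ (ℂ^{1+d})^n`: complex points `z = (z₀, …, z_{n-1})` with
`Im z₀ ∈ V₊` and `Im (z_k − z_{k-1}) ∈ V₊` for `k ≥ 1`, i.e. `Im z ∈ tubeCone d n`. The Wightman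
functions continue analytically to `𝒯ₙ` (Streater–Wightman (1964), §2-4 (tube `𝒯ₙ`), Thm. 3-5;
Osterwalder–Schrader I (1973), §4). [cite: StreaterWightman1964] -/
def forwardTube : Set (Fin n → Fin (d + 1) → ℂ) :=
  {z | ∀ k, imPart (succDiff z k) ∈ forwardCone d}

/-- Membership in the forward tube. [folklore] -/
@[simp]
theorem mem_forwardTube_iff (z : Fin n → Fin (d + 1) → ℂ) :
    z ∈ forwardTube d n ↔ ∀ k, imPart (succDiff z k) ∈ forwardCone d := Iff.rfl

/-- `z ∈ 𝒯ₙ ↔ Im z ∈ tubeCone d n`. [folklore] -/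
theorem mem_forwardTube_iff_imPart_mem_tubeCone (z : Fin n → Fin (d + 1) → ℂ) :
    z ∈ forwardTube d n ↔ (fun k => imPart (z k)) ∈ tubeCone d n := by
  simp only [mem_forwardTube_iff, mem_tubeCone_iff]
  refine forall_congr' fun k => ?_
  rw [succDiff_map imPart imPart_sub]

-- TODO: move `isOpen_forwardCone`, `smul_mem_forwardCone`, `smul_e₀_mem_forwardCone_iff` to
-- `MinkowskiGeometry` (pure forward-cone API).
/-- The open forward cone `V₊` is open. [folklore] -/
theorem isOpen_forwardCone : IsOpen (forwardCone d) := by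
  refine IsOpen.and (isOpen_lt continuous_const (EuclideanSpace.proj (0 : Fin (d + 1))).continuous)
    (isOpen_lt continuous_const ?_)
  exact ((minkowskiForm d).continuous₂).comp (continuous_id.prodMk continuous_id)

/-- The forward tube is open (finite intersection of preimages of the open cone `V₊` under
continuous maps; Streater–Wightman (1964), §2-4). [cite: StreaterWightman1964] -/
theorem isOpen_forwardTube : IsOpen (forwardTube d n) := by
  have hc : Continuous (imPart : (Fin (d + 1) → ℂ) → SpaceTime d) :=
    (PiLp.continuous_toLp 2 _).comp
      (continuous_pi fun μ => continuous_im.comp (continuous_apply μ))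
  have hs : ∀ k : Fin n, Continuous fun z : Fin n → Fin (d + 1) → ℂ => succDiff z k :=
    fun k => (continuous_apply k).sub ((continuous_apply _).comp
      (continuous_pi fun j => by
        refine Fin.cases ?_ (fun i => ?_) j
        · simpa using continuous_const
        · simpa using continuous_apply i))
  simp only [forwardTube, Set.setOf_forall]
  exact isOpen_iInter_of_finite fun k => isOpen_forwardCone.preimage (hc.comp (hs k))

/-- The forward cone is invariant under positive scaling. [folklore] -/
theorem smul_mem_forwardCone {p : SpaceTime d} (hp : p ∈ forwardCone d) {t : ℝ} (ht : 0 < t) :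
    t • p ∈ forwardCone d := by
  rw [mem_forwardCone_iff] at hp ⊢
  refine ⟨by simpa using mul_pos ht hp.1, ?_⟩
  rw [map_smul, map_smul]
  simpa using mul_pos ht (mul_pos ht hp.2)

/-- The ray `x + i t η`, `t > 0`, from a real point in a direction `η` of the base cone lies in
the forward tube (Streater–Wightman (1964), §3-3). [cite: StreaterWightman1964] -/
theorem mem_forwardTube_of_mem_tubeCone (x η : Fin n → SpaceTime d) (hη : η ∈ tubeCone d n)
    {t : ℝ} (ht : 0 < t) :
    (fun k => complexifyPoint (x k) + ((t : ℂ) * I) • complexifyPoint (η k)) ∈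
      forwardTube d n := by
  rw [mem_forwardTube_iff_imPart_mem_tubeCone]
  simp only [imPart_complexifyPoint_add_smul]
  intro k
  rw [succDiff_map (fun v : SpaceTime d => t • v) (fun a b => smul_sub t a b)]
  exact smul_mem_forwardCone (hη k) ht

/-- `t e₀ ∈ V₊ ↔ 0 < t`: the time axis meets the forward cone in its positive half. [folklore] -/
theorem smul_e₀_mem_forwardCone_iff (t : ℝ) : t • e₀ d ∈ forwardCone d ↔ 0 < t := by
  rw [mem_forwardCone_iff, map_smul, map_smul]
  simp only [PiLp.smul_apply, e₀_apply, if_true, smul_eq_mul, mul_one,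
    FunLike.coe_smul, Pi.smul_apply, minkowskiForm_e₀_e₀, and_iff_left_iff_imp]
  intro ht
  exact mul_pos ht ht

/-! ### Euclidean points -/

/-- The **Euclidean point** of complexified Minkowski space attached to a Euclidean configuration
`x = (x₀, …, x_{n-1}) ∈ (ℝ^{d+1})^n`: `(euclideanPoint x) k = (i x_k⁰, x⃗_k)` (purely imaginary
time, real space; Osterwalder–Schrader I (1973), §4, eq. (4.12); Streater–Wightman (1964), §3-4,
"Schwinger points"). [cite: StreaterWightman1964] -/
def euclideanPoint (x : Fin n → EuclideanSpace ℝ (Fin (d + 1))) : Fin n → Fin (d + 1) → ℂ :=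
  fun k μ => if μ = 0 then I * (x k 0 : ℂ) else (x k μ : ℂ)

/-- Time component of a Euclidean point: `i x_k⁰`. [folklore] -/
@[simp]
theorem euclideanPoint_apply_zero (x : Fin n → EuclideanSpace ℝ (Fin (d + 1))) (k : Fin n) :
    euclideanPoint x k 0 = I * (x k 0 : ℂ) := rfl

/-- Space components of a Euclidean point: `x_k^i`, real. [folklore] -/
@[simp]
theorem euclideanPoint_apply_succ (x : Fin n → EuclideanSpace ℝ (Fin (d + 1))) (k : Fin n)
    (i : Fin d) : euclideanPoint x k i.succ = (x k i.succ : ℂ) := by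
  simp [euclideanPoint, Fin.succ_ne_zero]

/-- The imaginary part of a Euclidean point is `x_k⁰ e₀` (Euclidean time along the imaginary
Minkowski time axis). [folklore] -/
@[simp]
theorem imPart_euclideanPoint (x : Fin n → EuclideanSpace ℝ (Fin (d + 1))) (k : Fin n) :
    imPart (euclideanPoint x k) = (x k 0) • e₀ d := by
  ext μ
  refine Fin.cases ?_ (fun i => ?_) μ
  · simp
  · simp [Fin.succ_ne_zero]

/-- A Euclidean configuration with strictly increasing positive times,
`0 < x₀⁰ < x₁⁰ < ⋯ < x_{n-1}⁰`, gives a point of the forward tube (Osterwalder–Schrader I (1973),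
§4, the region `𝒮_<`; Streater–Wightman (1964), §3-4). Real proof. [cite: StreaterWightman1964] -/
theorem euclideanPoint_mem_forwardTube {x : Fin n → EuclideanSpace ℝ (Fin (d + 1))}
    (h0 : ∀ k, 0 < x k 0) (hmono : StrictMono fun k => x k 0) :
    euclideanPoint x ∈ forwardTube d n := by
  rw [mem_forwardTube_iff_imPart_mem_tubeCone]
  simp only [imPart_euclideanPoint, mem_tubeCone_iff]
  intro k
  rw [succDiff_map (fun t : ℝ => t • e₀ d) (fun a b => sub_smul a b _), smul_e₀_mem_forwardCone_iff]
  cases n with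
  | zero => exact k.elim0
  | succ n =>
    refine Fin.cases ?_ (fun j => ?_) k
    · simpa using h0 0
    · simpa using hmono (Fin.castSucc_lt_succ (i := j))

/-- Points in the support of a time-ordered test function (`AQFT.IsTimeOrdered`, support in
`{0 < x₀⁰ < ⋯ < x_{n-1}⁰}`) have Euclidean points in the forward tube, so that
`∫ 𝔚 (euclideanPoint x) F x dx` only samples `𝔚` on `𝒯ₙ` (Osterwalder–Schrader I (1973), §4). [folklore] -/
theorem euclideanPoint_mem_forwardTube_of_isTimeOrdered
    {F : 𝓢((Fin n → EuclideanSpace ℝ (Fin (d + 1))), ℂ)} (hF : QuantumLattice.IsTimeOrdered F)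
    {x : Fin n → EuclideanSpace ℝ (Fin (d + 1))}
    (hx : x ∈ tsupport (F : (Fin n → EuclideanSpace ℝ (Fin (d + 1))) → ℂ)) :
    euclideanPoint x ∈ forwardTube d n :=
  euclideanPoint_mem_forwardTube (hF hx).1 (hF hx).2

/-! ### Boundary values and the Wick rotation -/

/-- The holomorphic function `𝔚` on the forward tube has the tempered distribution `T` as its
**distributional boundary value**: for every direction `η` in the base cone of `𝒯ₙ` and every
test function `F`, `∫ 𝔚(x + i t η) F(x) dx → T(F)` as `t → 0⁺`
(Streater–Wightman (1964), §3-3, Thm. 3-5 and eq. (3-36); Osterwalder–Schrader I (1973), §4,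
eq. (4.13)). The integral is the Bochner integral against Lebesgue measure on `(ℝ^{1+d})^n`;
by Mathlib's convention it is `0` when the integrand is not integrable (junk value; harmless
here since `T` is pinned independently by `IsWightmanDistributionOf` in all uses). [cite: StreaterWightman1964] -/
def HasDistributionalBoundaryValue (𝔚 : (Fin n → Fin (d + 1) → ℂ) → ℂ)
    (T : 𝓢((Fin n → SpaceTime d), ℂ) →L[ℂ] ℂ) : Prop :=
  ∀ η ∈ tubeCone d n, ∀ F : 𝓢((Fin n → SpaceTime d), ℂ),
    Tendsto (fun t : ℝ => ∫ x : Fin n → SpaceTime d,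
        𝔚 (fun k => complexifyPoint (x k) + ((t : ℂ) * I) • complexifyPoint (η k)) * F x)
      (𝓝[>] 0) (𝓝 (T F))

/-- The tempered distribution `T ∈ 𝒮'((ℝ^{1+d})^n)` is the `n`-point **Wightman distribution**
of the Wightman data `W` with field labels `k`: on tensor products it is the Wightman function,
`T (f₁ ⊗ ⋯ ⊗ fₙ) = ⟪Ω, φ_{k₁}(f₁) ⋯ φ_{kₙ}(fₙ) Ω⟫` (Streater–Wightman (1964), §3-3, eq. (3-19)
and the nuclear theorem; witness form with `AQFT.IsTensorOf`, outline A-D1). [cite: StreaterWightman1964] -/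
def IsWightmanDistributionOf (W : WightmanData d κ) (n : ℕ) (k : Fin n → κ)
    (T : 𝓢((Fin n → SpaceTime d), ℂ) →L[ℂ] ℂ) : Prop :=
  ∀ (f : Fin n → 𝓢(SpaceTime d, ℂ)) (F : 𝓢((Fin n → SpaceTime d), ℂ)),
    QuantumLattice.IsTensorOf F f → T F = W.wightmanFn n k f

/-- The Schwinger family `S` on Euclidean `ℝ^{d+1}` is the **Wick rotation** of the Wightman data
`W` (with field labels `k n` at order `n`): for every `n` there is a function `𝔚ₙ` holomorphic on
the forward tube `𝒯ₙ`, whose distributional boundary value is the `n`-point Wightman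
distribution of `W`, and whose values at Euclidean points give the Schwinger function on
time-ordered test functions, `𝔖ₙ(F) = ∫ 𝔚ₙ((i x_k⁰, x⃗_k)_k) F(x) dx` for `F ∈ 𝒮_<`
(Osterwalder–Schrader I (1973), §4, eqs. (4.12)–(4.14); Glimm–Jaffe (1987), §19.5;
Streater–Wightman (1964), §3-4). The Euclidean integral is the Bochner integral (junk value `0`
for non-integrable integrands, as in `HasDistributionalBoundaryValue`). [cite: GlimmJaffe1987] -/
def IsWickRotationOf (S : QuantumLattice.SchwingerFamily (EuclideanSpace ℝ (Fin (d + 1))))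
    (W : WightmanData d κ) (k : (n : ℕ) → Fin n → κ) : Prop :=
  ∀ n : ℕ, ∃ 𝔚 : (Fin n → Fin (d + 1) → ℂ) → ℂ,
    DifferentiableOn ℂ 𝔚 (forwardTube d n) ∧
    (∃ T : 𝓢((Fin n → SpaceTime d), ℂ) →L[ℂ] ℂ,
      IsWightmanDistributionOf W n (k n) T ∧ HasDistributionalBoundaryValue 𝔚 T) ∧
    ∀ F : 𝓢((Fin n → EuclideanSpace ℝ (Fin (d + 1))), ℂ), QuantumLattice.IsTimeOrdered F →
      S n F = ∫ x : Fin n → EuclideanSpace ℝ (Fin (d + 1)), 𝔚 (euclideanPoint x) * F x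

/-- An **Osterwalder–Schrader reconstruction** of the Schwinger family `S` with field labels in
`κ`: Wightman data `W` satisfying the Wightman axioms, a choice of labels, and the Wick-rotation
relation between `S` and `W`. This is the shape of the conclusion of the OS reconstruction
theorem "(E0') ∧ (E1)–(E4) ⇒ (W0)–(W4)" (Osterwalder–Schrader I (1973), §4, Thm. E→R;
II (1975), Thm. E'; Glimm–Jaffe (1987), §19.1). [cite: II1975] -/
structure OSReconstruction (S : QuantumLattice.SchwingerFamily (EuclideanSpace ℝ (Fin (d + 1))))
    (κ : Type*) where
  /-- The reconstructed Wightman data. -/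
  W : WightmanData d κ
  /-- The reconstructed data satisfy the Wightman axioms. -/
  isWightman : IsWightmanQFT W
  /-- The field labels whose Wightman functions continue to `S n`. -/
  label : (n : ℕ) → Fin n → κ
  /-- `S` is the Wick rotation of `W`. -/
  wick : IsWickRotationOf S W label

/-- Symmetry and real analyticity of the Schwinger functions at non-coincident points. If `S`
is the Wick rotation of a Wightman QFT of a single species (constant labels), then for each `n`
the Euclidean restriction `x ↦ 𝔚ₙ((i x_k⁰, x⃗_k)_k)` of the holomorphic Wightman function
extends from the time-ordered region `{0 < x₀⁰ < ⋯ < x_{n-1}⁰}` to a function `𝔖ₙ` which is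
*real analytic* on the open set of non-coincident configurations `{x | x_i ≠ x_j (i ≠ j)}` and
symmetric there under all permutations of its arguments (locality + Bargmann–Hall–Wightman: the
permuted extended tube contains all non-coincident Euclidean points, Streater–Wightman (1964),
§3-4, Thm. 3-6; Osterwalder–Schrader I (1973), §4, (4.12) with (E3); Glimm–Jaffe (1987),
§19.5, Cor. 19.5.6). The real-analyticity conjunct is the content: without it a discontinuous
symmetric extension exists trivially. The identification `S n F = ∫ 𝔖ₙ F` for *all* `F`
supported away from coincident points needs in addition the symmetry and temperedness of `S`
((E3), (E0')) and is not asserted here. Known theorem; proof deferred. [cite: StreaterWightman1964] -/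
def IsWickRotationOf.schwinger_symmetric : Prop :=
  ∀ {S : QuantumLattice.SchwingerFamily (EuclideanSpace ℝ (Fin (d + 1)))} {W : WightmanData d κ} {k : (n : ℕ) → Fin n → κ} (hW : IsWightmanQFT W) (h : IsWickRotationOf S W k) (hk : ∀ n (i j : Fin n), k n i = k n j) (n : ℕ),
    ∃ (𝔚 : (Fin n → Fin (d + 1) → ℂ) → ℂ) (𝔖 : (Fin n → EuclideanSpace ℝ (Fin (d + 1))) → ℂ),
      DifferentiableOn ℂ 𝔚 (forwardTube d n) ∧
      (∃ T, IsWightmanDistributionOf W n (k n) T ∧ HasDistributionalBoundaryValue 𝔚 T) ∧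
      (∀ F : 𝓢((Fin n → EuclideanSpace ℝ (Fin (d + 1))), ℂ), QuantumLattice.IsTimeOrdered F →
        S n F = ∫ x : Fin n → EuclideanSpace ℝ (Fin (d + 1)), 𝔚 (euclideanPoint x) * F x) ∧
      AnalyticOnNhd ℝ 𝔖 {x | Function.Injective x} ∧
      (∀ x : Fin n → EuclideanSpace ℝ (Fin (d + 1)), (∀ i, 0 < x i 0) →
        (StrictMono fun i => x i 0) → 𝔖 x = 𝔚 (euclideanPoint x)) ∧
      ∀ (σ : Equiv.Perm (Fin n)) (x : Fin n → EuclideanSpace ℝ (Fin (d + 1))),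
        Function.Injective x → 𝔖 (x ∘ σ) = 𝔖 x

/-! ### The complex Lorentz group and the extended tube -/

variable (d) in
/-- The **complexified Minkowski form** on `ℂ^{1+d}`, `η_ℂ(z, w) = z⁰ w⁰ − ∑ᵢ zⁱ wⁱ` (complex
bilinear, no conjugation; Streater–Wightman (1964), §2-4). On real points it is `minkowskiForm d`
(`complexMinkowskiForm_complexifyPoint`). [cite: StreaterWightman1964] -/
def complexMinkowskiForm : LinearMap.BilinForm ℂ (Fin (d + 1) → ℂ) :=
  LinearMap.mk₂ ℂ (fun z w => z 0 * w 0 - ∑ i : Fin d, z i.succ * w i.succ)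
    (fun z z' w => by
      simp only [Pi.add_apply, add_mul, Finset.sum_add_distrib]; ring)
    (fun c z w => by
      simp only [Pi.smul_apply, smul_eq_mul, mul_assoc, ← Finset.mul_sum]; ring)
    (fun z w w' => by
      simp only [Pi.add_apply, mul_add, Finset.sum_add_distrib]; ring)
    (fun c z w => by
      simp only [Pi.smul_apply, smul_eq_mul, mul_left_comm _ c, ← Finset.mul_sum]; ring)

/-- The defining formula of the complexified Minkowski form. [folklore] -/
theorem complexMinkowskiForm_apply (z w : Fin (d + 1) → ℂ) :
    complexMinkowskiForm d z w = z 0 * w 0 - ∑ i : Fin d, z i.succ * w i.succ := rfl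

/-- The complexified Minkowski form restricts to the real one. [folklore] -/
@[simp]
theorem complexMinkowskiForm_complexifyPoint (x y : SpaceTime d) :
    complexMinkowskiForm d (complexifyPoint x) (complexifyPoint y) = (minkowskiForm d x y : ℂ) := by
  simp [complexMinkowskiForm_apply]

variable (d) in
/-- The **complex Lorentz group** `L(ℂ) = O(1, d; ℂ)`: `ℂ`-linear automorphisms of `ℂ^{1+d}`
preserving the complexified Minkowski form, as a subgroup of
`(Fin (d + 1) → ℂ) ≃ₗ[ℂ] (Fin (d + 1) → ℂ)` (Streater–Wightman (1964), §2-4). [cite: StreaterWightman1964] -/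
def complexLorentzGroup : Subgroup ((Fin (d + 1) → ℂ) ≃ₗ[ℂ] (Fin (d + 1) → ℂ)) where
  carrier := {Λ | ∀ z w, complexMinkowskiForm d (Λ z) (Λ w) = complexMinkowskiForm d z w}
  mul_mem' {Λ Λ'} h h' z w := by
    simp only [Set.mem_setOf_eq] at h h'
    rw [LinearEquiv.mul_apply, LinearEquiv.mul_apply, h, h']
  one_mem' z w := rfl
  inv_mem' {Λ} h z w := by
    simp only [Set.mem_setOf_eq] at h
    rw [← h (Λ⁻¹ z) (Λ⁻¹ w)]
    simp

/-- Membership in the complex Lorentz group: `Λ` preserves `η_ℂ`. [folklore] -/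
@[simp]
theorem mem_complexLorentzGroup_iff (Λ : (Fin (d + 1) → ℂ) ≃ₗ[ℂ] (Fin (d + 1) → ℂ)) :
    Λ ∈ complexLorentzGroup d ↔
      ∀ z w, complexMinkowskiForm d (Λ z) (Λ w) = complexMinkowskiForm d z w := Iff.rfl

variable (d) in
/-- The **proper complex Lorentz group** `L₊(ℂ)`: complex Lorentz transformations of
determinant `1` (the kernel of `LinearEquiv.det`). It is connected and contains the restricted
real Lorentz group as well as the total reflection `−1` (Streater–Wightman (1964), §2-4). [cite: StreaterWightman1964] -/
def properComplexLorentzGroup : Subgroup ((Fin (d + 1) → ℂ) ≃ₗ[ℂ] (Fin (d + 1) → ℂ)) :=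
  complexLorentzGroup d ⊓ (LinearEquiv.det (R := ℂ) (M := Fin (d + 1) → ℂ)).ker

/-- Membership in `L₊(ℂ)`: preserve `η_ℂ` and have determinant `1`. [folklore] -/
theorem mem_properComplexLorentzGroup_iff (Λ : (Fin (d + 1) → ℂ) ≃ₗ[ℂ] (Fin (d + 1) → ℂ)) :
    Λ ∈ properComplexLorentzGroup d ↔ Λ ∈ complexLorentzGroup d ∧ LinearEquiv.det Λ = 1 :=
  Iff.rfl

variable (d n) in
/-- The **extended forward tube** `𝒯ₙ' = ⋃_{Λ ∈ L₊(ℂ)} Λ 𝒯ₙ`: images of forward-tube points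
under the diagonal action of the proper complex Lorentz group. By the Bargmann–Hall–Wightman
theorem the Wightman functions extend holomorphically (single-valued, `L₊(ℂ)`-invariant) to `𝒯ₙ'`,
which, unlike `𝒯ₙ`, contains real (Jost) points and all non-coincident Euclidean points up to
permutation (Streater–Wightman (1964), §2-4, §2-5, Thm. 2-11; §3-4). [cite: StreaterWightman1964] -/
def extendedForwardTube : Set (Fin n → Fin (d + 1) → ℂ) :=
  {z | ∃ Λ ∈ properComplexLorentzGroup d, ∃ w ∈ forwardTube d n, z = fun k => Λ (w k)}

/-- The forward tube is contained in the extended tube (take `Λ = 1`). [folklore] -/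
theorem forwardTube_subset_extendedForwardTube : forwardTube d n ⊆ extendedForwardTube d n :=
  fun z hz => ⟨1, Subgroup.one_mem _, z, hz, rfl⟩

/-- The extended tube is invariant under the diagonal action of `L₊(ℂ)`. [folklore] -/
theorem mem_extendedForwardTube_of_mem {z : Fin n → Fin (d + 1) → ℂ}
    (hz : z ∈ extendedForwardTube d n) {Λ : (Fin (d + 1) → ℂ) ≃ₗ[ℂ] (Fin (d + 1) → ℂ)}
    (hΛ : Λ ∈ properComplexLorentzGroup d) : (fun k => Λ (z k)) ∈ extendedForwardTube d n := by
  obtain ⟨Λ', hΛ', w, hw, rfl⟩ := hz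
  exact ⟨Λ * Λ', Subgroup.mul_mem _ hΛ hΛ', w, hw, rfl⟩

variable (d n) in
/-- The **permuted extended forward tube** `𝒯ₙ'^{perm} = ⋃_σ σ 𝒯ₙ'`: complex points some
permutation of which lies in the extended tube. With locality, the Wightman functions extend
holomorphically to it (Streater–Wightman (1964), §3-4, proof of Thm. 3-6; Glimm–Jaffe (1987),
§19.5). Note: in the textbook difference-variable convention it contains every non-coincident
Euclidean point; with the present convention (`Im z₀ ∈ V₊` is part of `𝒯ₙ`, see the module
docstring) this holds only up to a common translation of the points. [cite: StreaterWightman1964] -/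
def permutedExtendedForwardTube : Set (Fin n → Fin (d + 1) → ℂ) :=
  ⋃ σ : Equiv.Perm (Fin n), {z | (fun k => z (σ k)) ∈ extendedForwardTube d n}

/-- The extended tube is contained in the permuted extended tube (take `σ = 1`). [folklore] -/
theorem extendedForwardTube_subset_permutedExtendedForwardTube :
    extendedForwardTube d n ⊆ permutedExtendedForwardTube d n :=
  fun z hz => Set.mem_iUnion.2 ⟨1, by simpa using hz⟩

/-- The complexification `Λ_ℂ z = Λ (Re z) + i Λ (Im z)` of a real linear automorphism of
space-time, acting on `ℂ^{1+d}` (Streater–Wightman (1964), §2-4: `L↑₊ ⊆ L₊(ℂ)`). [cite: StreaterWightman1964] -/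
def lorentzActC (Λ : SpaceTime d ≃L[ℝ] SpaceTime d) (z : Fin (d + 1) → ℂ) : Fin (d + 1) → ℂ :=
  complexifyPoint (Λ (rePart z)) + (I : ℂ) • complexifyPoint (Λ (imPart z))

/-- `Im (Λ_ℂ z) = Λ (Im z)`. [folklore] -/
@[simp]
theorem imPart_lorentzActC (Λ : SpaceTime d ≃L[ℝ] SpaceTime d) (z : Fin (d + 1) → ℂ) :
    imPart (lorentzActC Λ z) = Λ (imPart z) := by
  ext μ; simp [lorentzActC]

/-- `Re (Λ_ℂ z) = Λ (Re z)`. [folklore] -/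
@[simp]
theorem rePart_lorentzActC (Λ : SpaceTime d ≃L[ℝ] SpaceTime d) (z : Fin (d + 1) → ℂ) :
    rePart (lorentzActC Λ z) = Λ (rePart z) := by
  ext μ; simp [lorentzActC]

/-- The forward tube is invariant under the diagonal action of the restricted Lorentz group
(`Λ V₊ = V₊` for orthochronous `Λ`; Streater–Wightman (1964), §2-4). Proof deferred. [cite: StreaterWightman1964] -/
def lorentzActC_mem_forwardTube : Prop :=
  ∀ (Λ : restrictedLorentzGroup d) {z : Fin n → Fin (d + 1) → ℂ} (hz : z ∈ forwardTube d n),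
    (fun k => lorentzActC (Λ : SpaceTime d ≃L[ℝ] SpaceTime d) (z k)) ∈ forwardTube d n

/-- The Bargmann–Hall–Wightman theorem (Streater–Wightman (1964), Thm. 2-11, in the form used
in §3-3): a function holomorphic on the forward tube and invariant there under the (diagonal,
complexified) action of the restricted real Lorentz group extends to a holomorphic function on
the extended tube, invariant under `L₊(ℂ)`. Known theorem; proof deferred. [cite: StreaterWightman1964] -/
def exists_extension_extendedForwardTube : Prop :=
  ∀ (𝔚 : (Fin n → Fin (d + 1) → ℂ) → ℂ) (h𝔚 : DifferentiableOn ℂ 𝔚 (forwardTube d n)) (hinv : ∀ Λ : restrictedLorentzGroup d, ∀ z ∈ forwardTube d n, 𝔚 (fun k => lorentzActC (Λ : SpaceTime d ≃L[ℝ] SpaceTime d) (z k)) = 𝔚 z),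
    ∃ 𝔚' : (Fin n → Fin (d + 1) → ℂ) → ℂ, DifferentiableOn ℂ 𝔚' (extendedForwardTube d n) ∧
      Set.EqOn 𝔚' 𝔚 (forwardTube d n) ∧
      ∀ Λ ∈ properComplexLorentzGroup d, ∀ z ∈ extendedForwardTube d n,
        𝔚' (fun k => Λ (z k)) = 𝔚' z

end Literature.MathematicalPhysics.QuantumLattice
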